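import Literature.IUT.LogThetaLattice.GlobalLGPFrobenioidsWeightedDiagonal
import HarnessLib

/-!
# [IUTchIII] Prop. 3.7 (v) at the category level — the DEGREE NORMALISATION of the one-copy model of `†𝒞^⊩_LGP`
# (abc-iut cell, layer L6; proof-only companion of abc-iut-L6-t4's `GlobalLGPFrobenioidsWeightedDiagonal.lean`;
# node IUTchIII:Prop3.7(v), SUBDAG-IUTchIII-Prop-37 "Frobenioid (categorical) level"; written by abc-iut-w4-d015)

S. Mochizuki, *Inter-universal Teichmüller theory III*, kurims manuscript (May 2020), §3, Proposition 3.7 (v)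
p. 111 l. 68–95 (the realified product embedding `𝒞^⊩_LGP ↪ Π_{j∈𝔽_l^⋇} (†𝓕⊛ℝ_MOD)_j`) [claim: Mochizuki2012,
status: disputed], together with *II* Cor. 4.5 (v) / Rmk. 4.5.4 (the weights `j²`) and T. Dupuy, A. Hilado,
*The statement of Mochizuki's Corollary 3.12*, Def. 3.1.1 / §3.3 (the lgp-degree `deĝ_lgp` = the AVERAGE over
`j ∈ 𝔽_l^⋇` of the degrees of the components) [cite: DupuyHilado2025, Def. 3.1.1].

WHY THIS FILE. In abc-iut-L6-t4's categorical model the global realified LGP-Frobenioid `†𝒞^⊩_LGP` ("isomorphic to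
`𝒞^⊩_mod`", [IUTchII] Cor. 4.5 (v)) is ONE copy of the realification `Prop37.FrakRlfCat F`, parametrised by the
LABEL-`1` component, and the realified product embedding of Prop. 3.7 (v) is the weighted-diagonal functor
`Prop37.embDiag` (`α ↦ (j²·α)_j`). Consequently the NATIVE arithmetic degree `frakDeg Y.obj` of an object `Y` of
this model is the weight-`1` degree, whereas the lgp-degree OF RECORD of the cell (abc-iut-c312-3's
`LgpDivisor.degLgp`, `PilotData.degLgp_thetaPilot`; [IUTchIV] Thm. 1.10 Step (v)'s coefficient
`(l⋆+1)(2l⋆+1)/6`) is the PROCESSION AVERAGE of the degrees of the embedded components. This file proves the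
conversion once and for all (no definition is introduced):

* (private) `sum_sqWt_cast` — `6 · Σ_{j=1}^{l⋆} j² = l⋆(l⋆+1)(2l⋆+1)`;
* `sum_frakDeg_embDiag_obj` / **`avg_frakDeg_embDiag_obj`** — for every object `Y` of `†𝒞^⊩_LGP` and `l⋆ ≥ 1`,
  `(1/l⋆) · Σ_j frakDeg ((embDiag Y)_j) = ((l⋆+1)(2l⋆+1)/6) · frakDeg Y`;
* `avg_frakDeg_embDiag_obj_ne` — for `l⋆ ≥ 2` and `frakDeg Y ≠ 0` the two normalisations DIFFER (the average
  weight exceeds `1`), so reading "the degree of an object of `†𝒞^⊩_LGP`" off `Y.obj` instead of through the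
  embedding is a genuine normalisation slip, not a convention.

Nothing here asserts a disputed claim or takes a side on [IUTchIII] Cor. 3.12; typed ≠ discharged; instantiated ≠
endorsed.
-/

noncomputable section

namespace Literature.IUT.LogThetaLattice

namespace Prop37

open CategoryTheory NumberField GlobalFrobenioidModels

variable {F : Type} [Field F] [NumberField F]

/-- `6 · Σ_{i < l⋆} (i+1)² = l⋆ (l⋆+1) (2l⋆+1)` in `ℝ` (the square-pyramidal identity behind the average LGP
weight `(l⋆+1)(2l⋆+1)/6` of [IUTchIV] Thm. 1.10, Step (v)). [folklore] -/
private theorem sum_sqWt_cast (lstar : ℕ) :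
    6 * ∑ i : Fin lstar, ((sqWt i : ℕ) : ℝ) = (lstar : ℝ) * (lstar + 1) * (2 * lstar + 1) := by
  simp only [sqWt]
  push_cast
  rw [Finset.mul_sum]
  induction lstar with
  | zero => simp
  | succ n ih =>
    rw [Fin.sum_univ_castSucc]
    simp only [Fin.val_castSucc, Fin.val_last]
    rw [ih]
    push_cast
    ring

/-- **Sum of the degrees of the realified product embedding** ([IUTchIII] Prop. 3.7 (v); weights of [IUTchII]
Rmk. 4.5.4): `6 · Σ_j frakDeg((embDiag Y)_j) = l⋆(l⋆+1)(2l⋆+1) · frakDeg Y`. [claim: Mochizuki2012, status: disputed] -/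
theorem sum_frakDeg_embDiag_obj (lstar : ℕ) (Y : FrakRlfCat F) :
    6 * ∑ i : Fin lstar, frakDeg ((embDiag F lstar).obj Y i).obj
      = ((lstar : ℝ) * (lstar + 1) * (2 * lstar + 1)) * frakDeg Y.obj := by
  simp only [frakDeg_embDiag_obj]
  rw [← Finset.sum_mul, ← mul_assoc, sum_sqWt_cast]

/-- **The lgp-degree of record through the embedding**: for `l⋆ ≥ 1` and every object `Y` of the one-copy model
of `†𝒞^⊩_LGP`, the PROCESSION AVERAGE of the degrees of its realified product embedding is
`((l⋆+1)(2l⋆+1)/6) · frakDeg Y` — the conversion between the native (label-`1`) degree of the model and the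
lgp-degree `deĝ_lgp` of abc-iut-c312-3 / Dupuy–Hilado (cf. `PilotData.degLgp_thetaPilot`).
[claim: Mochizuki2012, status: disputed] -/
theorem avg_frakDeg_embDiag_obj {lstar : ℕ} (hl : 0 < lstar) (Y : FrakRlfCat F) :
    (1 / (lstar : ℝ)) * ∑ i : Fin lstar, frakDeg ((embDiag F lstar).obj Y i).obj
      = (((lstar : ℝ) + 1) * (2 * lstar + 1) / 6) * frakDeg Y.obj := by
  have hl' : (lstar : ℝ) ≠ 0 := by exact_mod_cast hl.ne'
  have h := sum_frakDeg_embDiag_obj lstar Y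
  have h' : ∑ i : Fin lstar, frakDeg ((embDiag F lstar).obj Y i).obj
      = ((lstar : ℝ) * (lstar + 1) * (2 * lstar + 1)) / 6 * frakDeg Y.obj := by
    rw [div_mul_eq_mul_div, ← h]; ring
  rw [h']
  field_simp

/-- The average LGP weight exceeds `1` as soon as `l⋆ ≥ 2`: `(l⋆+1)(2l⋆+1)/6 > 1`. [folklore] -/
private theorem one_lt_avgSqWt {lstar : ℕ} (hl : 2 ≤ lstar) : (1 : ℝ) < ((lstar : ℝ) + 1) * (2 * lstar + 1) / 6 := by
  have h2 : (2 : ℝ) ≤ lstar := by exact_mod_cast hl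
  rw [lt_div_iff₀ (by norm_num : (0 : ℝ) < 6)]
  nlinarith

/-- **The two normalisations differ**: for `l⋆ ≥ 2` and an object `Y` of nonzero degree, the procession average of
the embedded degrees is NOT the native degree `frakDeg Y` — so "the degree of an object of `†𝒞^⊩_LGP`" must be read
through the realified product embedding of Prop. 3.7 (v), never off the label-`1` parameter of the one-copy model.
[claim: Mochizuki2012, status: disputed] -/
theorem avg_frakDeg_embDiag_obj_ne {lstar : ℕ} (hl : 2 ≤ lstar) (Y : FrakRlfCat F) (hY : frakDeg Y.obj ≠ 0) :
    (1 / (lstar : ℝ)) * ∑ i : Fin lstar, frakDeg ((embDiag F lstar).obj Y i).obj ≠ frakDeg Y.obj := by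
  rw [avg_frakDeg_embDiag_obj (lt_of_lt_of_le two_pos hl) Y]
  intro h
  have h1 : (((lstar : ℝ) + 1) * (2 * lstar + 1) / 6 - 1) * frakDeg Y.obj = 0 := by rw [sub_mul, one_mul, h, sub_self]
  rcases mul_eq_zero.mp h1 with h2 | h2
  · exact (one_lt_avgSqWt hl).ne' (sub_eq_zero.mp h2)
  · exact hY h2

/-- Objects of nonzero degree exist (degrees are surjective onto `ℝ`), so the discrepancy of
`avg_frakDeg_embDiag_obj_ne` is WITNESSED for every `l⋆ ≥ 2`. [claim: Mochizuki2012, status: disputed] -/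
theorem exists_avg_frakDeg_embDiag_obj_ne {lstar : ℕ} (hl : 2 ≤ lstar) :
    ∃ Y : FrakRlfCat F,
      (1 / (lstar : ℝ)) * ∑ i : Fin lstar, frakDeg ((embDiag F lstar).obj Y i).obj ≠ frakDeg Y.obj := by
  obtain ⟨Y, hY⟩ := FrakRlfCat.frakDeg_obj_surjective (F := F) 1
  exact ⟨Y, avg_frakDeg_embDiag_obj_ne hl Y (by rw [show frakDeg Y.obj = 1 from hY]; exact one_ne_zero)⟩

end Prop37

end Literature.IUT.LogThetaLattice

end
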